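import Summits.BirchSwinnertonDyer.BirchSwinnertonDyer.Theorems.ThetaPartnerAtTwoSignedControlAtTwoCoinvOfResTwo
import Summits.BirchSwinnertonDyer.BirchSwinnertonDyer.Theorems.ThetaPartnerAtTwoSignedControlAtTwoShaTwoVanishingHolds
import Summits.BirchSwinnertonDyer.BirchSwinnertonDyer.Theorems.PublishedInputsGreenbergControlAtTwoOfFour
import Literature.NumberTheory.EllipticCurves.Greenberg1999.LocalQuotientControlSurjectiveProofs
import Literature.NumberTheory.EllipticCurves.IwasawaNoFiniteSubmoduleProofs
import HarnessLib

/-!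
# Greenberg LNM 1716 p. 119, «`H¹(F_Σ/F_∞, E[p^∞])_Γ = 0`», and the CONCLUSION of Prop. 4.9 / 4.12 for the `Σ`-ramified group —
# PROVED in the regime `Sel_{p^∞}(E/K)` finite, `E(K)[p] = 0` (every reduction type at `p`), by the Cassels descent of «DIV»

Seat `bsd-inputs-k4-p1` (gen 3; LADDER-BSD D-0154 KEY (147)(f) «prove the printed input», row 1 K4 INPUTS; `--supports`
stmt-BirchSwinnertonDyer-20309). THEOREMS ONLY (no definition, no named fact, no `sorry`).

## What is proved

Let `K` be a number field, `E = W/K` elliptic, `p` a prime, `κ` the CYCLOTOMIC `ℤ_p`-extension with topological generator `γ`,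
`S₀` a finite set of finite places off which (and off `p`) `E` has good reduction, and
`H_Σ = H¹(K_Σ/K_∞, E[p^∞]) = GreenbergVatsal2000.unramifiedOutside (ker κ) E[p^∞] p S₀` (`Σ = S₀ ∪ {v ∣ p} ∪ ∞`).

* §1 `forall_exists_conjH1_sub_eq_unramifiedOutside` — **«DIV» DESCENDS from `H¹(K_∞, E[p^∞])` to `H_Σ`**: if
  `Sel_{p^∞}(E/K)` is finite, `E[p^∞]^{Γ_K} = 0` and every class of `H¹(K_∞, E[p^∞])` is `conj_γ t − t` (DIV for the full
  group, hypothesis `hdiv`), then every `s ∈ H_Σ` is `conj_γ t − t` with `t ∈ H_Σ`; i.e. **`(H_Σ)_Γ = H_Σ/(γ − 1)H_Σ = 0`** —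
  Greenberg's sentence «We must now explain why `H¹(F_Σ/F_∞, E[p^∞])_Γ` is zero» (p. 119; the input of the exact second row
  of Lemma 4.7, p. 108). PROOF (Greenberg's own diagram chase of Lemma 4.7 / p. 108, run as the K4 line's LIFT): DIV gives
  `t ∈ H¹(K_∞, E[p^∞])`; `t` is unramified outside a finite `S₁ ⊇ S₀` (AEU, `SignedEC.ResTwo.exists_finset_mem_unramifiedOutside`);
  all `conj_σ t − t` lie in `H_Σ` (`SSFlatEC.conjH1_sub_mem_of_conjH1_generator_sub_mem`); at each `v ∈ S₁ ∖ S₀`, `v ∤ p`, the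
  local class of `t` is `Γ_{K_v}`-invariant modulo Kummer, hence lifts to `K_v` (Greenberg p. 108,
  `Greenberg1999.localQuotient_restriction_surjective_all`, via `SSFlatEC.exists_localLift_of_localSurj`); CASSELS
  (`InputsPoitouTateSelmer.casselsSurjectivity_H1Sigma_holds`, Prop. 4.13, a theorem for every `K`) realises these local classes by
  ONE `y ∈ H¹(K_{Σ₁}/K, E[p^∞])`; then `t − res y ∈ H_Σ` (Kummer-trivial ⟹ unramified at good `v ∤ p`,
  `X2.GreenbergVatsalSelmerLink.localKerOver_le_unramKer`) and `conj_γ (t − res y) − (t − res y) = conj_γ t − t = s`.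
* §2 `dual_invariants_eq_bot_unramifiedOutside`, `dual_forall_finite_eq_bot_unramifiedOutside` — hence EVERY `Λ`-module `Y`
  mapped injectively into `Hom(H_Σ, ℚ/ℤ)` with `T ↦ conj_γ − 1` (the Pontryagin-dual datum axiom of
  `Greenberg1999.prop49_noFiniteSubmodule_H1Sigma` / `prop412_noFiniteSubmodule_H1Sigma_of_rank_one`) has `Y[T] = 0` and
  **no nonzero finite `Λ`-submodule** — the CONCLUSION «`H¹(F_Σ/F_∞, E[p^∞])` has no proper `Λ`-submodule of finite index»
  of Prop. 4.9 (p. 113) / Prop. 4.12 (p. 119), same hypotheses.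
* §3 UNCONDITIONAL instances, `hdiv` discharged by `SignedEC.PrimaryTorsionH2.forall_exists_conjH1_sub_eq_{real,odd,complex}`
  (this lineage, p634253: Poitou–Tate over `K`): `K` totally real — in particular `K = ℚ` — at EVERY `p`; any `K` at odd `p`;
  `K` totally complex at every `p` (over `ℚ` use `…_real`; Mathlib's `IsTotallyReal ℚ`). Remaining hypotheses: `κ` cyclotomic,
  `Sel_{p^∞}(E/K)` finite, `E(K)[p] = 0`.

## Honest framing

These are NOT Prop. 4.9 / 4.12 as printed: Greenberg assumes `Sel_E(F_∞)_p` `Λ`-cotorsion (4.9), resp. `Λ`-corank `[F:ℚ]`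
(4.12, = weak Leopoldt), for ANY `E`, and proves them through `H²(Gal(F_Σ/F), Hom(Λ, E[p^∞]))` (pp. 114–118, absent from the
tree). Here the SAME CONCLUSIONS are proved in the regime `Sel_{p^∞}(E/K)` finite ∧ `E(K)[p] = 0` (at a supersingular `p` this
regime is NOT covered by Prop. 4.9, whose hypothesis fails by Thm. 1.7, and is covered by Prop. 4.12 only through Kato's
Thm. 12.4), from finite-level Poitou–Tate + Cassels, all tree theorems. The named facts `prop49_…` / `prop412_…` are NOT
discharged (different hypotheses). No item is closed; no crux and no summit statement is proved by this seat; the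
Birch–Swinnerton-Dyer conjecture is NOT proved by any of this.

References: [GreenbergLNM1716] §4 p. 104, Lemma 4.7 (pp. 107–108), Prop. 4.9 (p. 113), Prop. 4.12 + p. 119, Prop. 4.13 (p. 122);
[GreenbergVatsal2000] §2 pp. 16–17; [MilneADT2006] I Thm. 4.10; [SilvermanAEC2009] Cor. X.4.4; [Washington1997] §13.2.
-/

set_option autoImplicit false
-- the Theorems namespace of this sub repeats the summit name by design (D-0017 nested layout)
set_option linter.dupNamespace false

noncomputable section

open scoped Classical NumberField

open NumberField IsDedekindDomain Field

namespace Summit.BirchSwinnertonDyer.BirchSwinnertonDyer.Theorems.SignedEC.SigmaDiv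

open Literature.NumberTheory.EllipticCurves Literature.NumberTheory.GaloisRepresentations
  WeierstrassCurve ZpExtension Literature.NumberTheory.EllipticCurves.IwasawaAlgebra
  Literature.NumberTheory.EllipticCurves.GreenbergVatsal2000 Literature.NumberTheory.EllipticCurves.GreenbergSelmer
  Summit.BirchSwinnertonDyer.Rank1Residual.X2

variable {K : Type} [Field K] [NumberField K] (W : WeierstrassCurve K) [W.IsElliptic] (p : ℕ) [hp : Fact p.Prime]
  (κ : ZpExtension K p) {γ : absoluteGaloisGroup K}

/-! ## §1 DIV descends to `H¹(K_Σ/K_∞, E[p^∞])`: `(H_Σ)_Γ = 0` -/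

/-- **Greenberg LNM 1716 p. 119, «`H¹(F_Σ/F_∞, E[p^∞])_Γ = 0`» — in the regime `Sel_{p^∞}(E/K)` finite, `E[p^∞]^{Γ_K} = 0`,
GIVEN «DIV» for the full group.** For `W/K` elliptic over a number field, `κ` the cyclotomic `ℤ_p`-extension with topological
generator `γ`, `S₀` finite with good reduction off `S₀ ∪ {v ∣ p}`, `Sel_{p^∞}(E/K)` finite, `#E[p^∞]^{Γ_K} = 1`, and every class
of `H¹(K_∞, E[p^∞])` of the form `conj_γ t − t` (`hdiv`): every `s ∈ H_Σ = unramifiedOutside (ker κ) E[p^∞] p S₀` is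
`conj_γ t − t` for some `t ∈ H_Σ`. The Cassels descent of Lemma 4.7 / p. 108 (AEU, Greenberg p. 108 at `v ∤ p`, Cassels
Prop. 4.13 — all tree theorems — then Silverman X.4.4 to return to the unramified condition).
[cite: GreenbergLNM1716, §4 Lemma 4.7 (pp. 107–108), p. 119, Prop. 4.13 (p. 122)] [cite: GreenbergVatsal2000, §2 pp. 16–17]
[cite: SilvermanAEC2009, Cor. X.4.4] -/
theorem forall_exists_conjH1_sub_eq_unramifiedOutside (hκ : κ.IsCyclotomic) (hγ : κ.IsTopGenerator γ)
    (S₀ : Set (HeightOneSpectrum (𝓞 K))) (hS₀ : S₀.Finite)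
    (hgood : ∀ v : HeightOneSpectrum (𝓞 K), v ∉ S₀ → ((p : ℕ) : 𝓞 K) ∉ v.asIdeal → W.HasGoodReductionAt v)
    (hSel : Finite (W.selmerGroupPInfty p))
    (hE : Nat.card (MulAction.fixedPoints (absoluteGaloisGroup K) (W.geomPrimaryTorsion p)) = 1)
    (hdiv : ∀ s : W.subgroupH1 p κ.kerSubgroup,
      ∃ t : W.subgroupH1 p κ.kerSubgroup, W.conjH1 p κ.kerSubgroup γ t - t = s)
    (s : W.subgroupH1 p κ.kerSubgroup) (hs : s ∈ unramifiedOutside κ.kerSubgroup (W.geomPrimaryTorsion p) p S₀) :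
    ∃ t ∈ unramifiedOutside κ.kerSubgroup (W.geomPrimaryTorsion p) p S₀, W.conjH1 p κ.kerSubgroup γ t - t = s := by
  set HS := unramifiedOutside κ.kerSubgroup (W.geomPrimaryTorsion p) p S₀ with hHS
  obtain ⟨t, ht⟩ := hdiv s -- DIV in the full group `H¹(K_∞, E[p^∞])`
  -- `H_Σ` is `Γ_K`-stable, so every `conj_σ t − t` lies in `H_Σ`
  have hstab : ∀ (σ : absoluteGaloisGroup K), ∀ x ∈ HS, W.conjH1 p κ.kerSubgroup σ x ∈ HS := fun σ x hx ↦
    conjH1_mem_unramifiedOutside κ.kerSubgroup (W.geomPrimaryTorsion p) p _ σ hx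
  have htγ : W.conjH1 p κ.kerSubgroup γ t - t ∈ HS := by rw [ht]; exact hs
  have htall : ∀ σ : absoluteGaloisGroup K, W.conjH1 p κ.kerSubgroup σ t - t ∈ HS :=
    SSFlatEC.conjH1_sub_mem_of_conjH1_generator_sub_mem W κ hγ HS hstab htγ
  have hone : ∀ {A : AddSubgroup (W.subgroupH1 p κ.kerSubgroup)} {z : W.subgroupH1 p κ.kerSubgroup},
      W.conjH1 p κ.kerSubgroup 1 z ∈ A → z ∈ A := fun {A z} h ↦ by
    rwa [W.conjH1_one_holds p κ.kerSubgroup, AddMonoidHom.id_apply] at h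
  -- AEU: `t` is unramified outside a finite `S₁ ⊇ S₀`
  obtain ⟨S₁', -, htH'⟩ := SignedEC.ResTwo.exists_finset_mem_unramifiedOutside W p κ.kerSubgroup t
  set S₁ : Set (HeightOneSpectrum (𝓞 K)) := S₀ ∪ (↑S₁' : Set (HeightOneSpectrum (𝓞 K))) with hS₁def
  have hS₁ : S₁.Finite := hS₀.union S₁'.finite_toSet
  have hgood₁ : ∀ v : HeightOneSpectrum (𝓞 K), v ∉ S₁ → ((p : ℕ) : 𝓞 K) ∉ v.asIdeal → W.HasGoodReductionAt v :=
    fun v hv hpv ↦ hgood v (fun h ↦ hv (Or.inl h)) hpv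
  have htH : t ∈ unramifiedOutside κ.kerSubgroup (W.geomPrimaryTorsion p) p S₁ := by
    rw [mem_unramifiedOutside_iff] at htH' ⊢
    exact fun v hv hpv σ ↦ htH' v (fun h ↦ hv (Or.inr (Finset.mem_coe.mpr h))) hpv σ
  -- off `S₀ ∪ {v ∣ p}` the condition of `H_Σ` implies the classical Kummer condition over the cyclotomic tower
  have hle : ∀ v : HeightOneSpectrum (𝓞 K), v ∉ S₀ → ((p : ℕ) : 𝓞 K) ∉ v.asIdeal →
      HS ≤ W.localKerOver p κ.kerSubgroup (v.adicCompletion K) := fun v hv hpv x hx ↦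
    hone (GreenbergVatsalUnramifiedAway.unramKer_le_localKerOver_of_isCyclotomic (κ := κ) (v := v) (W := W) (p := p)
      hκ (hgood v hv hpv) hpv ((mem_unramifiedOutside_iff x).mp hx v hv hpv 1))
  -- local lifts at the finite places off `S₀ ∪ {v ∣ p}` (Greenberg p. 108)
  have hloc : ∀ v : HeightOneSpectrum (𝓞 K), v ∉ S₀ → ((p : ℕ) : 𝓞 K) ∉ v.asIdeal →
      ∃ xv : discreteH1 (localSubgroup (⊤ : Subgroup (absoluteGaloisGroup K)) (v.adicCompletion K))
          (localPoints W (v.adicCompletion K)),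
        (∃ k : ℕ, p ^ k • xv = 0) ∧
        ∀ y : W.subgroupH1 p (⊤ : Subgroup (absoluteGaloisGroup K)),
          W.localResOver p ⊤ (v.adicCompletion K) y = xv →
          t - W.resOfLe p (le_top : κ.kerSubgroup ≤ ⊤) y ∈ W.localKerOver p κ.kerSubgroup (v.adicCompletion K) :=
    fun v hv hpv ↦ SSFlatEC.exists_localLift_of_localSurj W κ
      (Greenberg1999.localQuotient_restriction_surjective_all K W p κ hκ v hpv) HS (hle v hv hpv) t htall
  -- prescribe the local classes: the lifts off `S₀ ∪ {v ∣ p}`, zero elsewhere and at `∞`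
  let x : ∀ v : HeightOneSpectrum (𝓞 K),
      discreteH1 (localSubgroup (⊤ : Subgroup (absoluteGaloisGroup K)) (v.adicCompletion K))
        (localPoints W (v.adicCompletion K)) := fun v ↦
    if h : (v ∉ S₀ ∧ ((p : ℕ) : 𝓞 K) ∉ v.asIdeal) then Classical.choose (hloc v h.1 h.2) else 0
  have hx_of : ∀ v (h : v ∉ S₀ ∧ ((p : ℕ) : 𝓞 K) ∉ v.asIdeal), x v = Classical.choose (hloc v h.1 h.2) :=
    fun v h ↦ dif_pos h
  have hx_tor : ∀ v, ∃ k : ℕ, p ^ k • x v = 0 := fun v ↦ by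
    by_cases h : (v ∉ S₀ ∧ ((p : ℕ) : 𝓞 K) ∉ v.asIdeal)
    · rw [hx_of v h]; exact (Classical.choose_spec (hloc v h.1 h.2)).1
    · rw [show x v = 0 from dif_neg h]; exact ⟨0, smul_zero _⟩
  let xi : ∀ w : InfinitePlace K,
      discreteH1 (localSubgroup (⊤ : Subgroup (absoluteGaloisGroup K)) w.Completion) (localPoints W w.Completion) :=
    fun _ ↦ 0
  -- CASSELS over `K` with the finite set `S₁`
  obtain ⟨y, hyH, hyfin, -⟩ := InputsPoitouTateSelmer.casselsSurjectivity_H1Sigma_holds K W p hSel hE S₁ hS₁ hgood₁ x xi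
    hx_tor (fun _ ↦ ⟨0, smul_zero _⟩)
  have hsplit : ∀ σ : absoluteGaloisGroup K,
      W.conjH1 p κ.kerSubgroup σ (t - W.resOfLe p (le_top : κ.kerSubgroup ≤ ⊤) y) =
        (W.conjH1 p κ.kerSubgroup σ t - t) + (t - W.resOfLe p (le_top : κ.kerSubgroup ≤ ⊤) y) := fun σ ↦ by
    rw [map_sub, SSFlatEC.conjH1_resOfLe_top W κ σ y]; abel
  -- `res y` is unramified outside `S₁` over `K_∞`
  have hyH' : W.resOfLe p (le_top : κ.kerSubgroup ≤ ⊤) y ∈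
      unramifiedOutside κ.kerSubgroup (W.geomPrimaryTorsion p) p S₁ :=
    SSFlatEC.resOfLe_mem_unramifiedOutside (W.geomPrimaryTorsion p) (le_top : κ.kerSubgroup ≤ ⊤) p S₁ hyH
  refine ⟨t - W.resOfLe p (le_top : κ.kerSubgroup ≤ ⊤) y, ?_, ?_⟩
  · -- membership in `H_Σ`
    rw [mem_unramifiedOutside_iff]
    intro v hv hpv σ
    rw [hsplit σ]
    refine AddSubgroup.add_mem _ (hone ((mem_unramifiedOutside_iff _).mp (htall σ) v hv hpv 1)) ?_
    by_cases h1 : v ∈ S₁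
    · -- `v ∈ S₁ ∖ S₀`, `v ∤ p`: Kummer-trivial by the choice of `x v`, hence unramified (Silverman X.4.4)
      have hk : t - W.resOfLe p (le_top : κ.kerSubgroup ≤ ⊤) y ∈ W.localKerOver p κ.kerSubgroup (v.adicCompletion K) :=
        (Classical.choose_spec (hloc v hv hpv)).2 y (by rw [hyfin v (Or.inl h1), hx_of v ⟨hv, hpv⟩])
      exact GreenbergVatsalSelmerLink.localKerOver_le_unramKer (W := W) (p := p) (H := κ.kerSubgroup)
        (hgood v hv hpv) hpv hk
    · -- `v ∉ S₁`: both `t` and `res y` are unramified at `v`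
      have h2 : t ∈ unramifiedKer κ.kerSubgroup (W.geomPrimaryTorsion p) v :=
        hone ((mem_unramifiedOutside_iff t).mp htH v h1 hpv 1)
      have h3 : W.resOfLe p (le_top : κ.kerSubgroup ≤ ⊤) y ∈ unramifiedKer κ.kerSubgroup (W.geomPrimaryTorsion p) v :=
        hone ((mem_unramifiedOutside_iff _).mp hyH' v h1 hpv 1)
      exact AddSubgroup.sub_mem _ h2 h3
  · -- `(conj_γ − 1)(t − res y) = (conj_γ − 1) t = s`
    rw [map_sub, SSFlatEC.conjH1_resOfLe_top W κ γ y, ← ht]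
    abel

/-! ## §2 The Pontryagin dual of `H¹(K_Σ/K_∞, E[p^∞])`: `Y[T] = 0`, no nonzero finite `Λ`-submodule -/

/-- **`Y[T] = 0` for every `Λ`-module `Y` mapped injectively into `Hom(H¹(K_Σ/K_∞, E[p^∞]), ℚ/ℤ)` with `T ↦ conj_γ − 1`**
(the Pontryagin-dual datum axiom of `Greenberg1999.prop49_noFiniteSubmodule_H1Sigma` / `prop412_…`), in the regime of §1
(`κ` cyclotomic, `Sel_{p^∞}(E/K)` finite, `E[p^∞]^{Γ_K} = 0`, DIV for the full group): a `T`-fixed functional vanishes on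
`(conj_γ − 1)H_Σ = H_Σ`. [cite: GreenbergLNM1716, §4 Appendix Prop. 4.12 (p. 119) and p. 104] -/
theorem dual_invariants_eq_bot_unramifiedOutside (hκ : κ.IsCyclotomic) (hγ : κ.IsTopGenerator γ)
    (S₀ : Set (HeightOneSpectrum (𝓞 K))) (hS₀ : S₀.Finite)
    (hgood : ∀ v : HeightOneSpectrum (𝓞 K), v ∉ S₀ → ((p : ℕ) : 𝓞 K) ∉ v.asIdeal → W.HasGoodReductionAt v)
    (hSel : Finite (W.selmerGroupPInfty p))
    (hE : Nat.card (MulAction.fixedPoints (absoluteGaloisGroup K) (W.geomPrimaryTorsion p)) = 1)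
    (hdiv : ∀ s : W.subgroupH1 p κ.kerSubgroup,
      ∃ t : W.subgroupH1 p κ.kerSubgroup, W.conjH1 p κ.kerSubgroup γ t - t = s)
    {Y : Type*} [AddCommGroup Y] [Module (IwasawaAlgebra p) Y]
    (dY : Y →+ (unramifiedOutside κ.kerSubgroup (W.geomPrimaryTorsion p) p S₀ →+ AddCircle (1 : ℚ)))
    (hinj : Function.Injective dY)
    (hT : ∀ (y : Y) (x : unramifiedOutside κ.kerSubgroup (W.geomPrimaryTorsion p) p S₀),
      dY ((PowerSeries.X : IwasawaAlgebra p) • y) x =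
        dY y ⟨W.conjH1 p κ.kerSubgroup γ x,
          conjH1_mem_unramifiedOutside κ.kerSubgroup (W.geomPrimaryTorsion p) p _ γ x.2⟩ - dY y x) :
    invariants p Y = ⊥ := by
  rw [eq_bot_iff]
  intro y hy
  rw [Submodule.mem_bot]
  rw [mem_invariants_iff] at hy
  apply hinj
  rw [map_zero]
  ext s
  obtain ⟨t, htH, ht⟩ := forall_exists_conjH1_sub_eq_unramifiedOutside W p κ hκ hγ S₀ hS₀ hgood hSel hE hdiv s s.2
  have h := hT y ⟨t, htH⟩
  rw [hy, map_zero, AddMonoidHom.zero_apply] at h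
  have hs : s = ⟨W.conjH1 p κ.kerSubgroup γ t,
      conjH1_mem_unramifiedOutside κ.kerSubgroup (W.geomPrimaryTorsion p) p _ γ htH⟩ - ⟨t, htH⟩ :=
    Subtype.ext (by rw [AddSubgroup.coe_sub]; exact ht.symm)
  rw [hs, map_sub, AddMonoidHom.zero_apply]
  exact h.symm

/-- **No nonzero finite `Λ`-submodule in the Pontryagin dual of `H¹(K_Σ/K_∞, E[p^∞])`** — the CONCLUSION of Greenberg's
Prop. 4.9 (p. 113) / Prop. 4.12 (p. 119) «`H¹(F_Σ/F_∞, E[p^∞])` has no proper `Λ`-submodule of finite index», in the regime of §1: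
`Y[T] = 0` and a nonzero finite `Λ`-submodule would meet `Y[T]` (`IwasawaAlgebra.forall_finite_eq_bot_of_forall_pow_smul_invariants_eq_zero`).
[cite: GreenbergLNM1716, §4 Appendix Prop. 4.9 (p. 113), Prop. 4.12 (p. 119)] [cite: Washington1997, §13.2] -/
theorem dual_forall_finite_eq_bot_unramifiedOutside (hκ : κ.IsCyclotomic) (hγ : κ.IsTopGenerator γ)
    (S₀ : Set (HeightOneSpectrum (𝓞 K))) (hS₀ : S₀.Finite)
    (hgood : ∀ v : HeightOneSpectrum (𝓞 K), v ∉ S₀ → ((p : ℕ) : 𝓞 K) ∉ v.asIdeal → W.HasGoodReductionAt v)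
    (hSel : Finite (W.selmerGroupPInfty p))
    (hE : Nat.card (MulAction.fixedPoints (absoluteGaloisGroup K) (W.geomPrimaryTorsion p)) = 1)
    (hdiv : ∀ s : W.subgroupH1 p κ.kerSubgroup,
      ∃ t : W.subgroupH1 p κ.kerSubgroup, W.conjH1 p κ.kerSubgroup γ t - t = s)
    {Y : Type*} [AddCommGroup Y] [Module (IwasawaAlgebra p) Y]
    (dY : Y →+ (unramifiedOutside κ.kerSubgroup (W.geomPrimaryTorsion p) p S₀ →+ AddCircle (1 : ℚ)))
    (hinj : Function.Injective dY)
    (hT : ∀ (y : Y) (x : unramifiedOutside κ.kerSubgroup (W.geomPrimaryTorsion p) p S₀),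
      dY ((PowerSeries.X : IwasawaAlgebra p) • y) x =
        dY y ⟨W.conjH1 p κ.kerSubgroup γ x,
          conjH1_mem_unramifiedOutside κ.kerSubgroup (W.geomPrimaryTorsion p) p _ γ x.2⟩ - dY y x) :
    ∀ N : Submodule (IwasawaAlgebra p) Y, Finite N → N = ⊥ := by
  have hbot := dual_invariants_eq_bot_unramifiedOutside W p κ hκ hγ S₀ hS₀ hgood hSel hE hdiv dY hinj hT
  refine forall_finite_eq_bot_of_forall_pow_smul_invariants_eq_zero p fun x hx _ _ ↦ ?_
  rw [hbot] at hx
  exact (Submodule.mem_bot _).mp hx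

/-! ## §3 Unconditional instances: `K` totally real (every `p`), any `K` (odd `p`), `K` totally complex (every `p`) -/

section TotallyReal

variable {K : Type} [Field K] [NumberField K] [IsTotallyReal K] (W : WeierstrassCurve K) [W.IsElliptic]
  (p : ℕ) [hp : Fact p.Prime] (κ : ZpExtension K p) {γ : absoluteGaloisGroup K}

/-- **`H¹(K_Σ/K_∞, E[p^∞])_Γ = 0` for `K` totally real (e.g. `K = ℚ`), EVERY prime `p` — UNCONDITIONAL** in the regime
`κ` cyclotomic, `Sel_{p^∞}(E/K)` finite, `E(K)[p] = 0` (`hK`): §1 with DIV from `SignedEC.PrimaryTorsionH2.forall_exists_conjH1_sub_eq_real`.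
[cite: GreenbergLNM1716, §4 p. 119, Lemma 4.7 (pp. 107–108)] [cite: MilneADT2006, Ch. I, Thm. 4.10, Cor. 4.16] -/
theorem forall_exists_conjH1_sub_eq_unramifiedOutside_real (hκ : κ.IsCyclotomic) (hγ : κ.IsTopGenerator γ)
    (S₀ : Set (HeightOneSpectrum (𝓞 K))) (hS₀ : S₀.Finite)
    (hgood : ∀ v : HeightOneSpectrum (𝓞 K), v ∉ S₀ → ((p : ℕ) : 𝓞 K) ∉ v.asIdeal → W.HasGoodReductionAt v)
    [Finite (W.selmerGroupPInfty p)] (hK : ∀ P : W.toAffine.Point, p • P = 0 → P = 0)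
    (s : W.subgroupH1 p κ.kerSubgroup) (hs : s ∈ unramifiedOutside κ.kerSubgroup (W.geomPrimaryTorsion p) p S₀) :
    ∃ t ∈ unramifiedOutside κ.kerSubgroup (W.geomPrimaryTorsion p) p S₀, W.conjH1 p κ.kerSubgroup γ t - t = s :=
  forall_exists_conjH1_sub_eq_unramifiedOutside W p κ hκ hγ S₀ hS₀ hgood ‹_›
    (W.natCard_fixedPoints_absoluteGaloisGroup_geomPrimaryTorsion_eq_one (p := p) hK)
    (PrimaryTorsionH2.forall_exists_conjH1_sub_eq_real W p κ hγ hK) s hs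

/-- **No nonzero finite `Λ`-submodule in the dual of `H¹(K_Σ/K_∞, E[p^∞])`, `K` totally real (e.g. `ℚ`), EVERY `p` —
UNCONDITIONAL** (`κ` cyclotomic, `Sel_{p^∞}(E/K)` finite, `E(K)[p] = 0`): the conclusion of Prop. 4.9 / 4.12 in this regime.
[cite: GreenbergLNM1716, §4 Appendix Prop. 4.9 (p. 113), Prop. 4.12 (p. 119)] [cite: MilneADT2006, Ch. I, Thm. 4.10, Cor. 4.16] -/
theorem dual_forall_finite_eq_bot_unramifiedOutside_real (hκ : κ.IsCyclotomic) (hγ : κ.IsTopGenerator γ)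
    (S₀ : Set (HeightOneSpectrum (𝓞 K))) (hS₀ : S₀.Finite)
    (hgood : ∀ v : HeightOneSpectrum (𝓞 K), v ∉ S₀ → ((p : ℕ) : 𝓞 K) ∉ v.asIdeal → W.HasGoodReductionAt v)
    [Finite (W.selmerGroupPInfty p)] (hK : ∀ P : W.toAffine.Point, p • P = 0 → P = 0)
    {Y : Type*} [AddCommGroup Y] [Module (IwasawaAlgebra p) Y]
    (dY : Y →+ (unramifiedOutside κ.kerSubgroup (W.geomPrimaryTorsion p) p S₀ →+ AddCircle (1 : ℚ)))
    (hinj : Function.Injective dY)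
    (hT : ∀ (y : Y) (x : unramifiedOutside κ.kerSubgroup (W.geomPrimaryTorsion p) p S₀),
      dY ((PowerSeries.X : IwasawaAlgebra p) • y) x =
        dY y ⟨W.conjH1 p κ.kerSubgroup γ x,
          conjH1_mem_unramifiedOutside κ.kerSubgroup (W.geomPrimaryTorsion p) p _ γ x.2⟩ - dY y x) :
    ∀ N : Submodule (IwasawaAlgebra p) Y, Finite N → N = ⊥ :=
  dual_forall_finite_eq_bot_unramifiedOutside W p κ hκ hγ S₀ hS₀ hgood ‹_›
    (W.natCard_fixedPoints_absoluteGaloisGroup_geomPrimaryTorsion_eq_one (p := p) hK)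
    (PrimaryTorsionH2.forall_exists_conjH1_sub_eq_real W p κ hγ hK) dY hinj hT

end TotallyReal

section Odd

variable {K : Type} [Field K] [NumberField K] (W : WeierstrassCurve K) [W.IsElliptic]
  (p : ℕ) [hp : Fact p.Prime] (κ : ZpExtension K p) {γ : absoluteGaloisGroup K}

/-- **`H¹(K_Σ/K_∞, E[p^∞])_Γ = 0` for ANY number field `K` at an ODD prime — UNCONDITIONAL** (`κ` cyclotomic,
`Sel_{p^∞}(E/K)` finite, `E(K)[p] = 0`): §1 with DIV from `SignedEC.PrimaryTorsionH2.forall_exists_conjH1_sub_eq_odd`.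
[cite: GreenbergLNM1716, §4 p. 119, Lemma 4.7 (pp. 107–108)] [cite: MilneADT2006, Ch. I, Thm. 4.10 (a)] -/
theorem forall_exists_conjH1_sub_eq_unramifiedOutside_odd (hp2 : p ≠ 2) (hκ : κ.IsCyclotomic) (hγ : κ.IsTopGenerator γ)
    (S₀ : Set (HeightOneSpectrum (𝓞 K))) (hS₀ : S₀.Finite)
    (hgood : ∀ v : HeightOneSpectrum (𝓞 K), v ∉ S₀ → ((p : ℕ) : 𝓞 K) ∉ v.asIdeal → W.HasGoodReductionAt v)
    [Finite (W.selmerGroupPInfty p)] (hK : ∀ P : W.toAffine.Point, p • P = 0 → P = 0)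
    (s : W.subgroupH1 p κ.kerSubgroup) (hs : s ∈ unramifiedOutside κ.kerSubgroup (W.geomPrimaryTorsion p) p S₀) :
    ∃ t ∈ unramifiedOutside κ.kerSubgroup (W.geomPrimaryTorsion p) p S₀, W.conjH1 p κ.kerSubgroup γ t - t = s :=
  forall_exists_conjH1_sub_eq_unramifiedOutside W p κ hκ hγ S₀ hS₀ hgood ‹_›
    (W.natCard_fixedPoints_absoluteGaloisGroup_geomPrimaryTorsion_eq_one (p := p) hK)
    (PrimaryTorsionH2.forall_exists_conjH1_sub_eq_odd W p κ hp2 hγ hK) s hs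

/-- **No nonzero finite `Λ`-submodule in the dual of `H¹(K_Σ/K_∞, E[p^∞])`, ANY `K`, ODD `p` — UNCONDITIONAL**
(`κ` cyclotomic, `Sel_{p^∞}(E/K)` finite, `E(K)[p] = 0`).
[cite: GreenbergLNM1716, §4 Appendix Prop. 4.9 (p. 113), Prop. 4.12 (p. 119)] [cite: MilneADT2006, Ch. I, Thm. 4.10 (a)] -/
theorem dual_forall_finite_eq_bot_unramifiedOutside_odd (hp2 : p ≠ 2) (hκ : κ.IsCyclotomic) (hγ : κ.IsTopGenerator γ)
    (S₀ : Set (HeightOneSpectrum (𝓞 K))) (hS₀ : S₀.Finite)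
    (hgood : ∀ v : HeightOneSpectrum (𝓞 K), v ∉ S₀ → ((p : ℕ) : 𝓞 K) ∉ v.asIdeal → W.HasGoodReductionAt v)
    [Finite (W.selmerGroupPInfty p)] (hK : ∀ P : W.toAffine.Point, p • P = 0 → P = 0)
    {Y : Type*} [AddCommGroup Y] [Module (IwasawaAlgebra p) Y]
    (dY : Y →+ (unramifiedOutside κ.kerSubgroup (W.geomPrimaryTorsion p) p S₀ →+ AddCircle (1 : ℚ)))
    (hinj : Function.Injective dY)
    (hT : ∀ (y : Y) (x : unramifiedOutside κ.kerSubgroup (W.geomPrimaryTorsion p) p S₀),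
      dY ((PowerSeries.X : IwasawaAlgebra p) • y) x =
        dY y ⟨W.conjH1 p κ.kerSubgroup γ x,
          conjH1_mem_unramifiedOutside κ.kerSubgroup (W.geomPrimaryTorsion p) p _ γ x.2⟩ - dY y x) :
    ∀ N : Submodule (IwasawaAlgebra p) Y, Finite N → N = ⊥ :=
  dual_forall_finite_eq_bot_unramifiedOutside W p κ hκ hγ S₀ hS₀ hgood ‹_›
    (W.natCard_fixedPoints_absoluteGaloisGroup_geomPrimaryTorsion_eq_one (p := p) hK)
    (PrimaryTorsionH2.forall_exists_conjH1_sub_eq_odd W p κ hp2 hγ hK) dY hinj hT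

end Odd

section TotallyComplex

variable {K : Type} [Field K] [NumberField K] [IsTotallyComplex K] (W : WeierstrassCurve K) [W.IsElliptic]
  (p : ℕ) [hp : Fact p.Prime] (κ : ZpExtension K p) {γ : absoluteGaloisGroup K}

/-- **`H¹(K_Σ/K_∞, E[p^∞])_Γ = 0` for `K` totally complex, EVERY `p` — UNCONDITIONAL** (`κ` cyclotomic, `Sel_{p^∞}(E/K)`
finite, `E(K)[p] = 0`): §1 with DIV from `SignedEC.PrimaryTorsionH2.forall_exists_conjH1_sub_eq_complex`.
[cite: GreenbergLNM1716, §4 p. 119, Lemma 4.7 (pp. 107–108)] [cite: MilneADT2006, Ch. I, Thm. 4.10 (a), Thm. 6.13 (c)] -/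
theorem forall_exists_conjH1_sub_eq_unramifiedOutside_complex (hκ : κ.IsCyclotomic) (hγ : κ.IsTopGenerator γ)
    (S₀ : Set (HeightOneSpectrum (𝓞 K))) (hS₀ : S₀.Finite)
    (hgood : ∀ v : HeightOneSpectrum (𝓞 K), v ∉ S₀ → ((p : ℕ) : 𝓞 K) ∉ v.asIdeal → W.HasGoodReductionAt v)
    [Finite (W.selmerGroupPInfty p)] (hK : ∀ P : W.toAffine.Point, p • P = 0 → P = 0)
    (s : W.subgroupH1 p κ.kerSubgroup) (hs : s ∈ unramifiedOutside κ.kerSubgroup (W.geomPrimaryTorsion p) p S₀) :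
    ∃ t ∈ unramifiedOutside κ.kerSubgroup (W.geomPrimaryTorsion p) p S₀, W.conjH1 p κ.kerSubgroup γ t - t = s :=
  forall_exists_conjH1_sub_eq_unramifiedOutside W p κ hκ hγ S₀ hS₀ hgood ‹_›
    (W.natCard_fixedPoints_absoluteGaloisGroup_geomPrimaryTorsion_eq_one (p := p) hK)
    (PrimaryTorsionH2.forall_exists_conjH1_sub_eq_complex W p κ hγ hK) s hs

/-- **No nonzero finite `Λ`-submodule in the dual of `H¹(K_Σ/K_∞, E[p^∞])`, `K` totally complex, EVERY `p` —
UNCONDITIONAL** (`κ` cyclotomic, `Sel_{p^∞}(E/K)` finite, `E(K)[p] = 0`).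
[cite: GreenbergLNM1716, §4 Appendix Prop. 4.9 (p. 113), Prop. 4.12 (p. 119)] [cite: MilneADT2006, Ch. I, Thm. 4.10 (a)] -/
theorem dual_forall_finite_eq_bot_unramifiedOutside_complex (hκ : κ.IsCyclotomic) (hγ : κ.IsTopGenerator γ)
    (S₀ : Set (HeightOneSpectrum (𝓞 K))) (hS₀ : S₀.Finite)
    (hgood : ∀ v : HeightOneSpectrum (𝓞 K), v ∉ S₀ → ((p : ℕ) : 𝓞 K) ∉ v.asIdeal → W.HasGoodReductionAt v)
    [Finite (W.selmerGroupPInfty p)] (hK : ∀ P : W.toAffine.Point, p • P = 0 → P = 0)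
    {Y : Type*} [AddCommGroup Y] [Module (IwasawaAlgebra p) Y]
    (dY : Y →+ (unramifiedOutside κ.kerSubgroup (W.geomPrimaryTorsion p) p S₀ →+ AddCircle (1 : ℚ)))
    (hinj : Function.Injective dY)
    (hT : ∀ (y : Y) (x : unramifiedOutside κ.kerSubgroup (W.geomPrimaryTorsion p) p S₀),
      dY ((PowerSeries.X : IwasawaAlgebra p) • y) x =
        dY y ⟨W.conjH1 p κ.kerSubgroup γ x,
          conjH1_mem_unramifiedOutside κ.kerSubgroup (W.geomPrimaryTorsion p) p _ γ x.2⟩ - dY y x) :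
    ∀ N : Submodule (IwasawaAlgebra p) Y, Finite N → N = ⊥ :=
  dual_forall_finite_eq_bot_unramifiedOutside W p κ hκ hγ S₀ hS₀ hgood ‹_›
    (W.natCard_fixedPoints_absoluteGaloisGroup_geomPrimaryTorsion_eq_one (p := p) hK)
    (PrimaryTorsionH2.forall_exists_conjH1_sub_eq_complex W p κ hγ hK) dY hinj hT

end TotallyComplex

end Summit.BirchSwinnertonDyer.BirchSwinnertonDyer.Theorems.SignedEC.SigmaDiv

end
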